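import Summits.BirchSwinnertonDyer.BirchSwinnertonDyer.Theorems.CumulativeHeegnerLeopoldtLeopoldtKernelAtThree
import Summits.BirchSwinnertonDyer.BirchSwinnertonDyer.Theorems.UniversalToricDescentWildSplitFrameAtThreeOddOfPrintOfEngine
import HarnessLib

/-!
# Route `CumulativeHeegnerLeopoldt`: the kernel on the Leopoldt cell with crux K3 `WildSplitFrameAtThree`
# (20928, the ∀-`K` frame) RE-KEYED to the odd-`d_K` PRINT PACKAGE of `UniversalToricDescent`
# (24476 `WildSplitPrintedInputsAtThree` + 24475 `WildSplitFrameAtThreeOddOfPrint`, the latter CLOSED·proved)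

Cell `bsd-wall` (W-ALL, row 2@3), prover bsd-wall-utd-p3 g8 (UTD lineage of 20928 / 24475 / 24477), 2026-08-28 — the
same act as UTD rev 26–29 (kernel♯ 24477, utd-p3 g7) and SOED rev 9–11 (24609): chl-p1 g0's landed kernel
`leopoldtKernelAtThree_of_not_hasCM` (p596253) consumes K3 exactly ONCE, AFTER choosing its own Friedberg–Hoffstein
field `K` (`2` and all of `N(E)` split), where `d_K` is ODD (`SatisfiesHeegnerHypothesis.discr_emod_eight`). So the
∀-`K` crux 20928 can be replaced on CHL's deciding chain by the UTD items

* `Theses.UniversalToricDescent.WildSplitPrintedInputsAtThree` (24476: Hsieh 2014 Thm A any level ∧ BDP13 Thm 5.5 ∧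
  LZZ18 additive — refereed inputs by name) and
* `Theses.UniversalToricDescent.WildSplitFrameAtThreeOddOfPrint` (24475: the frame at ODD `d_K` from those inputs —
  CLOSED·proved, `Theorems.wildSplitFrameAtThreeOddOfPrint_proof`, p596578, via the Hsieh descent engine port p595848).

What this file proves (sorry-free, no definition, no named fact):

* `leopoldtKernelAtThree_of_not_hasCM_of_frameOdd` — chl-p1's kernel VERBATIM with `(h3 : WildSplitFrameAtThree)`
  replaced by `(hW : UTD.WildSplitPrintedInputsAtThree) (hS : UTD.WildSplitFrameAtThreeOddOfPrint)` and the single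
  call fed `hodd` (one line changed);
* `leopoldtKernelAtThree_of_not_hasCM_of_printedInputs` — the same with `hS` DISCHARGED by the tree theorem
  `wildSplitFrameAtThreeOddOfPrint_proof`: published inputs → LZZ → K1 → K2 → `WildSplitPrintedInputsAtThree` → K4 →
  K5 ⟹ `BSD₃(E)` on the non-CM Leopoldt cell — K3 is now PRINT for CHL;
* `wAllExclAddWildRankOne_of_cumulativeHeegnerLeopoldt_cruxes_of_printedInputs` — the would-be `closes` body with K3
  so replaced (K6 off the cell).

TURNKEY for the CHL pen (route edit is a planner verb): attach 24476 to CHL BY NAME (dedup, as UTD/SOED did), file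
the kernel item with `WildSplitFrameAtThree →` ↦ `WildSplitPrintedInputsAtThree →` (text of
`leopoldtKernelAtThree_of_not_hasCM_of_printedInputs` with the CHL copies of the decls — closes by `exact` up to
δ), re-key `closes (hF hL h1 h2 hW h4 h5 h6 hK)`, retriage 20928 → aside on CHL ⇒ CHL cruxes 4 → 3
(K1 24198, K2 24199, K4 24200 [⟸ PT×2], residuals Z 20387 / K6 24201). HONEST: every remaining crux and the
printed inputs are ANTECEDENTS; BSD is not proved for any curve by this file.

References: [JetchevSkinnerWan2017] §7.4.1 (arXiv:1512.06894 p. 30); [Hsieh2014] Thm. A; [BertoliniDarmonPrasanna2013]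
Thm. 5.5; [LiuZhangZhang2018] Thm. 1.5.1/1.5.3; [FriedbergHoffstein1995] Thm. B; [GrossZagier1986] Thm. I.(6.3).
-/

noncomputable section

open scoped Classical

set_option linter.dupNamespace false
set_option autoImplicit false

namespace Summit.BirchSwinnertonDyer.BirchSwinnertonDyer.Theorems

open WeierstrassCurve NumberField IsDedekindDomain Field
  Literature.NumberTheory.EllipticCurves
  Literature.NumberTheory.EllipticCurves.ModularForms
  Literature.NumberTheory.EllipticCurves.LiuZhangZhang2018
  Literature.NumberTheory.EllipticCurves.Rank1Residual
  Literature.NumberTheory.EllipticCurves.KrizLi2019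
  Summit.BirchSwinnertonDyer.Rank1Residual
  Summit.BirchSwinnertonDyer.Rank1Residual.Additive
  Summit.BirchSwinnertonDyer.Rank1Residual.X11b
  Summit.BirchSwinnertonDyer.Rank1Residual.X11b.AcSelmer
  Summit.BirchSwinnertonDyer.Rank1Residual.X11b.Halves
  Summit.BirchSwinnertonDyer.BirchSwinnertonDyer.Theses.CumulativeHeegnerLeopoldt

/-- **The kernel on the Leopoldt cell, non-CM tail, with K3 at ODD `d_K` (kernel♯ for CHL).** Published inputs →
`LiuZhangZhangAdditiveInput` → K1 → K2 → `UTD.WildSplitPrintedInputsAtThree` → `UTD.WildSplitFrameAtThreeOddOfPrint` →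
K4 → K5 ⟹ `BSD₃(E)` for every globally minimal NON-CM `E/ℚ` on `ClassO6 W 3` with `r_an = 1`, `E[3]` reducible and a
non-anomalous rational line. chl-p1 g0's `leopoldtKernelAtThree_of_not_hasCM` with the K3 call fed the kernel's own
`hodd` — one line changed. CONDITIONAL on every displayed hypothesis; closes nothing by itself.
[cite: JetchevSkinnerWan2017, §7.4.1 (arXiv:1512.06894 p. 30)] [cite: FriedbergHoffstein1995, Thm. B]
[cite: LiuZhangZhang2018, Thm 1.5.1 and Thm 1.5.3] -/
theorem leopoldtKernelAtThree_of_not_hasCM_of_frameOdd (hF : ToricPublishedInputs) (hL : LiuZhangZhangAdditiveInput)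
    (h1 : CumulativeHeegnerInclusionAtThree) (h2 : EisensteinCharacterInvariantsAtThree)
    (hW : Theses.UniversalToricDescent.WildSplitPrintedInputsAtThree)
    (hS : Theses.UniversalToricDescent.WildSplitFrameAtThreeOddOfPrint)
    (h4 : RedSplitControlAtThree) (h5 : WildRankZeroTwistAtThree)
    (W : WeierstrassCurve ℚ) [W.IsElliptic] [W.IsGloballyMinimal] (hCM : ¬ W.HasCM) (hO6 : ClassO6 W 3)
    (hr : W.analyticRank = 1) (hRed : Red W 3)
    (hcell : ∃ Φ : AddSubgroup (WeierstrassCurve.geomTorsion W ((3 : ℕ) : ℤ)), IsRationalLine W 3 Φ ∧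
      ∀ (v : IsDedekindDomain.HeightOneSpectrum (NumberField.RingOfIntegers ℚ)),
        ((3 : ℕ) : NumberField.RingOfIntegers ℚ) ∈ v.asIdeal → ∀ 𝔓 ∈ v.primesAbove,
          ¬ (∀ g ∈ 𝔓.decompositionSubgroup (Field.absoluteGaloisGroup ℚ), ∀ P ∈ Φ, g • P = P) ∧
          ¬ (∀ g ∈ 𝔓.decompositionSubgroup (Field.absoluteGaloisGroup ℚ),
              ∀ P : WeierstrassCurve.geomTorsion W ((3 : ℕ) : ℤ), g • P - P ∈ Φ)) :
    BSDp W 3 := by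
  -- adapted from Theorems/CumulativeHeegnerLeopoldtLeopoldtKernelAtThree.lean (chl-p1 g0): K3 ↦ (24476, 24475)
  obtain ⟨hGZ, hKo, hGZK, hmod, hmodP, -, hGZ73, hFH, hpar, hHP⟩ := hF
  haveI hN0 : NeZero (W.conductorNorm ℤ) := ⟨W.conductorNorm_pos_holds.ne'⟩
  -- (a) DATA. parity: `r_an = 1` is odd, so `w(E) = -1`
  have hw : W.rootNumber = -1 := by
    rcases W.rootNumber_eq_one_or with h | h
    · exfalso
      have heven : Even W.analyticRank := (hpar W).mpr h
      rw [hr] at heven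
      exact Nat.not_even_one heven
    · exact h
  -- Friedberg–Hoffstein with auxiliary modulus `2`: Heegner for `N(E)` and `2` split, so `d_K` is odd
  obtain ⟨K, _, _, hK, -, hHN, hH2, hLt⟩ := hFH W hw 2 two_ne_zero 0
  have hodd : Odd (NumberField.discr K) := by
    have h8 := Literature.SatisfiesHeegnerHypothesis.discr_emod_eight hK.1 hH2 (dvd_refl 2)
    rw [Int.odd_iff]; omega
  -- `3 ∣ N(E)` (additive) splits in `K`
  have h3N : 3 ∣ W.conductorNorm ℤ :=
    (W.dvd_conductorNorm_iff_not_hasGoodReductionAtPrime 3).mpr (not_good_of_addv W 3 hO6.2.1)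
  have hsplit : SplitsIn K 3 := hHN 3 Nat.prime_three h3N
  -- the Heegner point over `K` and its data; non-torsion by Gross–Zagier
  obtain ⟨P, Dt, H, ι, hP⟩ := hHP W K hK hHN
  have hL0 : W.entireLFunction 1 = 0 := entireLFunction_one_eq_zero_of_analyticRank_eq_one hr
  obtain ⟨-, hderiv⟩ := leadingLCoeff_eq_deriv_of_analyticRank_eq_one hr
  have hLK : LDerivEK W K ≠ 0 := by
    rw [lDerivEK_eq_deriv_mul W K hmod hL0]; exact mul_ne_zero hderiv hLt
  have hnt : ¬ IsOfFinAddOrder P :=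
    (lDerivEK_ne_zero_iff_not_isOfFinAddOrder W (W.conductorNorm ℤ) K (hGZ _ W K) hK hHN
      ⟨Dt, H, ι, hP⟩).mp hLK
  -- Kolyvagin: `rank E(K) = 1`, `Ш(E/K)` finite
  obtain ⟨hrk, hfin⟩ := hKo (W.conductorNorm ℤ) W K hK hHN ⟨Dt, H, ι, hP⟩ hnt
  -- a frame `(κ, γ, 𝔭)` and the other prime `𝔭′ ≠ 𝔭` above `3`
  obtain ⟨κ, γ, -, hκ, hγ, -⟩ := X11b.exists_anticyclotomic_generator_prime (p := 3) hK
  haveI : Fact (κ.IsTopGenerator γ) := ⟨hγ⟩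
  obtain ⟨𝔭, h𝔭, he, hf⟩ := X11b.exists_degreeOnePrime_of_splitsIn K 3 hK.1 hsplit
  obtain ⟨𝔭', hne, h𝔭', he', hf'⟩ := X11b.Three.exists_ne_degreeOne_prime hK.1 h𝔭 he hf
  -- (b) PLUMBING. K3: an `R₀`-frame `L` at `(κ, γ, 𝔭)`; its unit value by LZZ
  obtain ⟨ι', hind, ΩK, Ωp, L, hΩK, hΩp, hBDP⟩ :=
    hS hW.1 hW.2.1 W (W.conductorNorm ℤ) K Dt hO6 rfl hK hHN hodd κ hκ γ 𝔭 h𝔭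
  -- the unit value `L(𝟙) = u·(log_𝔭 P / c)²`, `u ∈ R₀ˣ` (♭-rigidity + LZZ; the scalar `[T⁰]L / x²` lies in
  -- `Frac R₀` with norm one, hence in `R₀ˣ`) — the body of UTD's `wildSplitWaldspurgerAtThree_of_lzz_of_frame`
  obtain ⟨u, hval⟩ : ∃ u : (unrIntegers 3)ˣ, L.HasValueAt 0 ((((u : unrIntegers 3) : unrIntegers 3) : ℂ_[3]) *
      (algebraMap ℚ_[3] ℂ_[3] (logOmega W 3 (embAt K 3 𝔭 h𝔭 he hf) P / (Dt.c : ℚ_[3]))) ^ 2) := by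
    have hQ' : R1.IsBDPLFunctionInt 3 ι' 𝔭 κ γ Dt.f ΩK Ωp (PowerSeries.map (R1.unrToCpInt 3) L) :=
      R1.isBDPLFunctionInt_map hBDP
    obtain ⟨u₀, hu₀, hv⟩ := UniversalToricDescentWaldspurgerFlat.wildSplitWaldspurgerAtThree_flat_forall hL W
      (W.conductorNorm ℤ) K Dt H ι P hO6 rfl hK hHN hP hnt κ hκ γ 𝔭 h𝔭 he hf ι' hind hΩK hΩp hQ'
    set x : ℚ_[3] := logOmega W 3 (embAt K 3 𝔭 h𝔭 he hf) P / (Dt.c : ℚ_[3]) with hx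
    have hv' : L.HasValueAt 0 (u₀ * (algebraMap ℚ_[3] ℂ_[3] x) ^ 2) :=
      (R1.intSeries_hasValueAt_map_iff 3 L _ _).mp hv
    have hcoef : ((PowerSeries.constantCoeff L : unrIntegers 3) : ℂ_[3]) =
        u₀ * (algebraMap ℚ_[3] ℂ_[3] x) ^ 2 :=
      (UnrSeries.eq_constantCoeff_of_hasValueAt_zero hv').symm
    have hlogne : logOmega W 3 (embAt K 3 𝔭 h𝔭 he hf) P ≠ 0 := R1.logOmega_ne_zero W 3 _ hnt
    have hcZ : Dt.c ≠ 0 := Dt.maninConstant_ne_zero_holds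
    have hx0 : x ≠ 0 := div_ne_zero hlogne (by exact_mod_cast hcZ)
    have hx2 : x ^ 2 ≠ 0 := pow_ne_zero _ hx0
    set y : ℂ_[3] := algebraMap ℚ_[3] ℂ_[3] (x ^ 2) with hy
    have hy0 : y ≠ 0 := (map_ne_zero_iff _ (algebraMap ℚ_[3] ℂ_[3]).injective).mpr hx2
    have hnorm : ‖((PowerSeries.constantCoeff L : unrIntegers 3) : ℂ_[3])‖ = ‖y‖ := by
      rw [hcoef, norm_mul, hu₀, one_mul, hy, map_pow]
    have hyF : y ∈ Subfield.closure (unrIntegers 3 : Set ℂ_[3]) := by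
      rw [hy, IsScalarTower.algebraMap_apply ℚ_[3] (PadicAlgCl 3) ℂ_[3] (x ^ 2)]
      exact PadicComplexTransport.algebraMap_padic_mem_fracUnr 3 (x ^ 2)
    set c₀ : ℂ_[3] := ((PowerSeries.constantCoeff L : unrIntegers 3) : ℂ_[3]) with hc₀
    have hw : c₀ / y ∈ Subfield.closure (unrIntegers 3 : Set ℂ_[3]) :=
      div_mem (Subfield.subset_closure (PowerSeries.constantCoeff L).2) hyF
    have hw1 : ‖c₀ / y‖ = 1 := by
      rw [norm_div, hc₀, hnorm, div_self (norm_ne_zero_iff.mpr hy0)]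
    have hwR : c₀ / y ∈ unrIntegers 3 := R1.mem_unrIntegers_of_mem_fracUnr hw hw1.le
    obtain ⟨u, hu⟩ := (unrIntegers.isUnit_iff_norm_eq_one ⟨c₀ / y, hwR⟩).mpr hw1
    refine ⟨u, ?_⟩
    have hval : ((u : unrIntegers 3) : ℂ_[3]) * (algebraMap ℚ_[3] ℂ_[3] x) ^ 2 = c₀ := by
      rw [hu, ← map_pow, ← hy]
      exact div_mul_cancel₀ c₀ hy0
    have h0 := L.hasValueAt_zero
    rw [← hc₀, ← hval] at h0
    exact h0
  -- K1: the inclusion `(L) ⊆ Ch·R₀⟦T⟧` at `𝔭′`; K2: the norm profile; hence the IMC EQUALITY at the frame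
  have hincl : Ideal.span {L} ≤
      (XAc.charIdeal (W.baseChange K) 3 κ 𝔭' ∅ γ).map (PowerSeries.map (toUnr 3)) :=
    h1 W (W.conductorNorm ℤ) K Dt hO6 hRed hcell hr rfl hK hHN κ hκ γ 𝔭 h𝔭 he hf 𝔭' h𝔭' hne ι' hind ΩK Ωp L
      hΩK hΩp hBDP
  obtain ⟨g, n₀, hg, hglt, -, -, hLn⟩ := h2 W (W.conductorNorm ℤ) K Dt hO6 hRed hcell hr rfl hK hHN κ hκ γ 𝔭
    h𝔭 he hf 𝔭' h𝔭' hne ι' hind ΩK Ωp L hΩK hΩp hBDP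
  have heq : (XAc.charIdeal (W.baseChange K) 3 κ 𝔭' ∅ γ).map (PowerSeries.map (toUnr 3)) =
      Ideal.span {L} :=
    UniversalToricDescentNormProfile.eq_span_of_span_le_of_normProfile hg hincl hglt hLn
  -- K4: control EQUALITY at `𝔭′` (CTL₀ included)
  have hctl : SchneiderFree.AdditiveControlOnTreeAt 3 κ 𝔭' γ (embAt K 3 𝔭' h𝔭' he' hf') P :=
    h4 W (W.conductorNorm ℤ) K Dt H ι P hO6 hRed hcell hr rfl hK hHN hLt hP hnt (hKo _ W K) κ hκ γ 𝔭'
      h𝔭' he' hf'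
  obtain ⟨n, hn, hneq⟩ := hctl
  -- the value read through the logarithm at `𝔭′` (rank one: `(log_{𝔭′} P)² = (log_𝔭 P)²`)
  have hval' : L.HasValueAt 0 ((((u : unrIntegers 3) : unrIntegers 3) : ℂ_[3]) *
      (algebraMap ℚ_[3] ℂ_[3]
        (logOmega W 3 (embAt K 3 𝔭' h𝔭' he' hf') P / (Dt.c : ℚ_[3]))) ^ 2) :=
    (SchneiderFreeAdditiveX3.hasValueAt_sq_logOmega_embAt_iff_of_rank_one W 3 hK.1 hrk h𝔭 he hf
      h𝔭' he' hf' P _ _ L).mpr hval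
  -- both sockets at slack `v₃(c)` at the frame `(κ, 𝔭′, γ, embAt 𝔭′)`
  have hc0 : Dt.c ≠ 0 := Dt.maninConstant_ne_zero_holds
  have hlog : logOmega W 3 (embAt K 3 𝔭' h𝔭' he' hf') P ≠ 0 := X11b.R1.logOmega_ne_zero W 3 _ hnt
  have hlow : SchneiderFree.AdditiveIMCLowerBDPOnTreeLeAt 3 κ 𝔭' γ (embAt K 3 𝔭' h𝔭' he' hf')
      (padicValNat 3 Dt.c.natAbs) P := by
    -- the LOWER norm receptacle (`⊆` + value): `2·ord₃(log_{𝔭′}P / c) ≤ ord₃ f(0)`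
    obtain ⟨htors, f, hfI, hf0, hfn⟩ := hn
    have hmem : PowerSeries.map (toUnr 3) f ∈ Ideal.span {L} := by
      have h3 := heq.le
      rw [hfI, CongruenceLimit.map_span_singleton_powerSeries] at h3
      exact (Ideal.span_singleton_le_iff_mem _).mp h3
    obtain ⟨-, hle⟩ := Supersingular.two_mul_valuation_le_of_mem_span 3 hf0 hmem u hval'
    have hc0' : (Dt.c : ℚ_[3]) ≠ 0 := by exact_mod_cast hc0
    rw [div_eq_mul_inv, Padic.valuation_mul hlog (inv_ne_zero hc0'), Padic.valuation_inv,
      Padic.valuation_intCast, valuation_logOmega hlog, hfn] at hle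
    refine ⟨n, ⟨htors, f, hfI, hf0, hfn⟩, ?_⟩
    simp only [padicValInt] at hle
    linarith
  have hup : SchneiderFree.Upper.AdditiveIMCUpperBDPOnTreeLeAt 3 κ 𝔭' γ (embAt K 3 𝔭' h𝔭' he' hf')
      (padicValNat 3 Dt.c.natAbs) P :=
    SchneiderFree.Upper.additiveIMCUpperBDPOnTreeLeAt_of_value_of_dvd' hn heq.ge u hc0 hlog hval'
  -- the EXACT index at slack `v₃(c)` (both halves), by K1's links with the control equality
  have hlo : SchneiderFree.IndexLowerBoundLeAt W 3 K P (padicValNat 3 Dt.c.natAbs) :=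
    SchneiderFreeAdditiveX3.indexLowerBoundLeAt_of_imcLowerLe_of_control rfl hK hHN hfin hlow
      ⟨n, hn, hneq⟩
  have hupI : SchneiderFree.Upper.IndexUpperBoundLeAt W 3 K P (padicValNat 3 Dt.c.natAbs) :=
    SchneiderFree.Upper.indexUpperBoundLeAt_of_imcUpperLe_of_control rfl hK hHN hfin hup ⟨n, hn, hneq⟩
  -- (c) TERMINAL STEP: a globally minimal model of the twist — a NON-CM O6 row of analytic rank `0`
  have hD0 : (NumberField.discr K : ℚ) ≠ 0 := by exact_mod_cast NumberField.discr_ne_zero K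
  haveI : (W.quadraticTwist (NumberField.discr K : ℚ)).IsElliptic := W.isElliptic_quadraticTwist hD0
  obtain ⟨Cd, hCd⟩ := hasGlobalMinimalModel_rat_holds (W.quadraticTwist (NumberField.discr K : ℚ))
  haveI : (Cd • W.quadraticTwist (NumberField.discr K : ℚ)).IsGloballyMinimal := hCd
  set Wd : WeierstrassCurve ℚ := Cd • W.quadraticTwist (NumberField.discr K : ℚ) with hWd
  have hw3 : ¬ 3 ∣ Units.torsionOrder K :=
    (X11b.Three.not_dvd_discr_and_not_dvd_torsionOrder_of_heegner hK hHN (by decide) h3N).2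
  obtain ⟨hO6d, hjd⟩ := classO6_twist_of_heegner W hO6 K hK hHN hodd Wd Cd rfl
  have hCMd : ¬ Wd.HasCM := fun h ↦ hCM ((hasCM_iff_of_j_eq hjd).mp h)
  have hLd1 : Wd.entireLFunction 1 ≠ 0 := by rw [hWd, entireLFunction_smul]; exact hLt
  have hrd : Wd.analyticRank = 0 := analyticRank_eq_zero_of_entireLFunction_one_ne_zero Wd hLd1
  have hBSDd : BSDp Wd 3 := h5 Wd hCMd hO6d hrd
  exact SchneiderFree.Exact.bsdp_of_exactIndexManin_of_partner_bsdp hGZ hKo hGZK hmod hGZ73 W 3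
    (W.conductorNorm ℤ) K Dt H ι P Wd hr rfl h3N hK hodd hw3 hHN hLt hP ⟨Cd, rfl⟩ (by decide) hlo hupI hBSDd

/-- **K3 DISCHARGED modulo the printed inputs.** Published inputs → `LiuZhangZhangAdditiveInput` → K1 → K2 →
`UTD.WildSplitPrintedInputsAtThree` → K4 → K5 ⟹ `BSD₃(E)` on the non-CM Leopoldt cell: the odd-`d_K` frame is the TREE
THEOREM `wildSplitFrameAtThreeOddOfPrint_proof` (p596578; Hsieh descent engine p595848). This is the kernel item the
CHL pen should file in place of `LeopoldtKernelAtThree`'s K3 binder (text: this statement with the CHL copies of the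
decls). CONDITIONAL on the displayed hypotheses; closes nothing by itself.
[cite: JetchevSkinnerWan2017, §7.4.1 (arXiv:1512.06894 p. 30)] [cite: Hsieh2014, Thm. A]
[cite: BertoliniDarmonPrasanna2013, Thm. 5.5] -/
theorem leopoldtKernelAtThree_of_not_hasCM_of_printedInputs (hF : ToricPublishedInputs)
    (hL : LiuZhangZhangAdditiveInput) (h1 : CumulativeHeegnerInclusionAtThree)
    (h2 : EisensteinCharacterInvariantsAtThree) (hW : Theses.UniversalToricDescent.WildSplitPrintedInputsAtThree)
    (h4 : RedSplitControlAtThree) (h5 : WildRankZeroTwistAtThree)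
    (W : WeierstrassCurve ℚ) [W.IsElliptic] [W.IsGloballyMinimal] (hCM : ¬ W.HasCM) (hO6 : ClassO6 W 3)
    (hr : W.analyticRank = 1) (hRed : Red W 3)
    (hcell : ∃ Φ : AddSubgroup (WeierstrassCurve.geomTorsion W ((3 : ℕ) : ℤ)), IsRationalLine W 3 Φ ∧
      ∀ (v : IsDedekindDomain.HeightOneSpectrum (NumberField.RingOfIntegers ℚ)),
        ((3 : ℕ) : NumberField.RingOfIntegers ℚ) ∈ v.asIdeal → ∀ 𝔓 ∈ v.primesAbove,
          ¬ (∀ g ∈ 𝔓.decompositionSubgroup (Field.absoluteGaloisGroup ℚ), ∀ P ∈ Φ, g • P = P) ∧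
          ¬ (∀ g ∈ 𝔓.decompositionSubgroup (Field.absoluteGaloisGroup ℚ),
              ∀ P : WeierstrassCurve.geomTorsion W ((3 : ℕ) : ℤ), g • P - P ∈ Φ)) :
    BSDp W 3 :=
  leopoldtKernelAtThree_of_not_hasCM_of_frameOdd hF hL h1 h2 hW wildSplitFrameAtThreeOddOfPrint_proof h4 h5 W hCM
    hO6 hr hRed hcell

/-- **The leaf from CHL's cruxes with K3 replaced by the printed inputs** — the route's `closes` re-run: published
inputs → LZZ → K1 → K2 → `UTD.WildSplitPrintedInputsAtThree` → K4 → K5 → K6 ⟹ `WAllExclAddWildRankOne` (on the cell by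
`leopoldtKernelAtThree_of_not_hasCM_of_printedInputs`, off the cell by the declared residual K6). Every remaining crux
and the printed package are ANTECEDENTS; BSD is not proved by this. [cite: JetchevSkinnerWan2017, §7.4.1] -/
theorem wAllExclAddWildRankOne_of_cumulativeHeegnerLeopoldt_cruxes_of_printedInputs (hF : ToricPublishedInputs)
    (hL : LiuZhangZhangAdditiveInput) (h1 : CumulativeHeegnerInclusionAtThree)
    (h2 : EisensteinCharacterInvariantsAtThree) (hW : Theses.UniversalToricDescent.WildSplitPrintedInputsAtThree)
    (h4 : RedSplitControlAtThree) (h5 : WildRankZeroTwistAtThree) (h6 : WildRankOneOffLeopoldtCellAtThree) :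
    Summit.BirchSwinnertonDyer.WAllExclAddWildRankOne := by
  intro W _ _ hCM hO6 hr
  by_cases hcell : (Red W 3 ∧ (∃ Φ : AddSubgroup (WeierstrassCurve.geomTorsion W ((3 : ℕ) : ℤ)),
    IsRationalLine W 3 Φ ∧ ∀ (v : IsDedekindDomain.HeightOneSpectrum (NumberField.RingOfIntegers ℚ)),
      ((3 : ℕ) : NumberField.RingOfIntegers ℚ) ∈ v.asIdeal → ∀ 𝔓 ∈ v.primesAbove,
        ¬ (∀ g ∈ 𝔓.decompositionSubgroup (Field.absoluteGaloisGroup ℚ), ∀ P ∈ Φ, g • P = P) ∧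
        ¬ (∀ g ∈ 𝔓.decompositionSubgroup (Field.absoluteGaloisGroup ℚ),
            ∀ P : WeierstrassCurve.geomTorsion W ((3 : ℕ) : ℤ), g • P - P ∈ Φ)))
  · exact leopoldtKernelAtThree_of_not_hasCM_of_printedInputs hF hL h1 h2 hW h4 h5 W hCM hO6 hr hcell.1 hcell.2
  · exact h6 W hCM hO6 hr hcell

/-! ## §2 Closer of item 25837 `LeopoldtKernelAtThreeOfPrint` (cell `bsd-wall`, chl-p1 g6, 2026-08-28)

Route rev 3/4 (pen pss3 g15, TURNKEY-CHL-K3-utdp3g8) filed the kernel♯ item `LeopoldtKernelAtThreeOfPrint` = the text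
of `leopoldtKernelAtThree_of_not_hasCM_of_printedInputs` with the CHL copy of the print package
`Theses.CumulativeHeegnerLeopoldt.WildSplitPrintedInputsAtThree` (Hsieh 2014 Thm A any level ∧ BDP13 Thm 5.5 ∧ LZZ18
additive), which δ-unfolds to the UTD copy consumed above. The closer is the one-line re-binding. CONDITIONAL on every
displayed antecedent (K1, K2, K4, K5, the printed inputs); BSD is not proved for any curve by this. -/

/-- **Item 25837 `LeopoldtKernelAtThreeOfPrint` (kernel♯ on the Leopoldt cell) holds**: published inputs → LZZ → K1 →
K2 → `WildSplitPrintedInputsAtThree` → K4 → K5 ⟹ `BSD₃(E)` for every globally minimal non-CM `E/ℚ` on `ClassO6 W 3`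
with `r_an = 1`, `E[3]` reducible and a non-anomalous rational line — by
`leopoldtKernelAtThree_of_not_hasCM_of_printedInputs` (the two routes' copies of the print package agree up to δ).
Every antecedent is a displayed hypothesis of the item; nothing unconditional about BSD follows.
[cite: JetchevSkinnerWan2017, §7.4.1 (arXiv:1512.06894 p. 30)] [cite: Hsieh2014, Thm. A]
[cite: BertoliniDarmonPrasanna2013, Thm. 5.5] -/
theorem cumulativeHeegnerLeopoldt_leopoldtKernelAtThreeOfPrint_proof :
    Summit.BirchSwinnertonDyer.BirchSwinnertonDyer.Theses.CumulativeHeegnerLeopoldt.LeopoldtKernelAtThreeOfPrint :=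
  fun hF hL h1 h2 hW h4 h5 W _ _ hCM hO6 hr hRed hcell =>
    leopoldtKernelAtThree_of_not_hasCM_of_printedInputs hF hL h1 h2 hW h4 h5 W hCM hO6 hr hRed hcell

end Summit.BirchSwinnertonDyer.BirchSwinnertonDyer.Theorems

end
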